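import Summits.Ventures.PercRepro.ProfilePointedCircuitClassesStarSharpD0D
import Summits.Ventures.PercRepro.ProfilePointedCircuitClassesStarSharpD0J
import Summits.Ventures.PercRepro.ProfilePointedCircuitClassesStarSharpD0U
import Summits.Ventures.PercRepro.ProfilePointedCircuitClassesStarSharpV

/-!
# PercRepro — THE ASSEMBLY OF `StarNineSharp`, PART A: LOOPS AND THE COLOOPS OF `R = N ∖ {b, b′}`
(p5, gen 56; `proofs/P5-GM1.md` §84)

The degenerate regimes of the Prop `StarNineSharp` not covered by the case theorems: a LOOP kills every
bi-independent set (`biIndepSets_eq_empty_of_loop_pt`); a COLOOP `c` of `R = N ∖ {b, b′}` (`ρ(E₇ − c) = 3`) forces every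
bi-independent 4-set to contain exactly one of `c, b, b′` — with `c = f` the demands `T + b` (`e ∈ T`) inject into the
targets `T + f` (`inCount_thru_le_of_coloop_f`), with `c = e` every demand avoids `b` and is OFF, so the OFF injection
`W ↦ (E ∖ W) − b′` applies (`inCount_thru_le_of_coloop_e`), and with `c ∈ X` the demands `T + p` (`p ∈ {c, b}`) inject
into the targets `(E₇ − c − T) + p` (`inCount_thru_le_of_coloop_X`).
-/

open scoped Matroid

namespace PercRepro.Cogirth

open Finset ThmH Skew Shadow Profile

open Classical

variable {α : Type} [DecidableEq α] {N : Matroid α} [N.Finite]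

section StarSharpAsmA

variable {b b' : α}

/-- If `S ⊆ T` have the same rank and `z ∈ cl(T)`, then `z ∈ cl(S)` (a copy of the lemma of PencilD, so that this
module depends on the tree's D0D, D0J and StarSharpV only). -/
theorem rk_insert_eq_of_subset_rk_eq' {S T : Finset α} {z : α} (hST : S ⊆ T) (hrk : rk N T = rk N S)
    (hz : rk N (insert z T) = rk N T) : rk N (insert z S) = rk N S := by
  have h1 : rk N (insert z S) ≤ rk N (insert z T) := rk_mono' (insert_subset_insert _ hST)
  have h2 : rk N S ≤ rk N (insert z S) := rk_mono' (subset_insert _ _)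
  omega

/-- A loop does not raise the rank. -/
theorem rk_insert_eq_of_loop {x : α} (hx0 : rk N {x} = 0) (S : Finset α) : rk N (insert x S) = rk N S := by
  have h1 := rk_union_add_rk_le_of_subset_inter' (N := N) (S := S) (T := {x}) (I := ∅) (empty_subset _)
  have h2 : rk N (insert x S) ≤ rk N (S ∪ {x}) := rk_mono' (by
    intro z hz; rw [mem_insert] at hz; rcases hz with rfl | hz
    · exact mem_union_right _ (mem_singleton_self _)
    · exact mem_union_left _ hz)
  have h3 : rk N S ≤ rk N (insert x S) := rk_mono' (subset_insert _ _)
  have h0 : rk N (∅ : Finset α) = 0 := Nat.le_zero.1 ((rk_le_card' (M := N) ∅).trans (by rw [card_empty]))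
  rw [hx0, h0] at h1
  omega

/-- **A LOOP KILLS EVERY BI-INDEPENDENT SET**. -/
theorem biIndepSets_eq_empty_of_loop_pt {x : α} (hx : x ∈ gr N) (hx0 : rk N {x} = 0) (k : ℕ) :
    biIndepSets N k = ∅ := by
  rw [eq_empty_iff_forall_notMem]
  intro W hW
  obtain ⟨hWg, -, hWr, hWc⟩ := mem_biIndepSets.1 hW
  by_cases hxW : x ∈ W
  · have h1 : rk N W = rk N (W.erase x) := by
      conv_lhs => rw [← insert_erase hxW]
      exact rk_insert_eq_of_loop hx0 _
    have h2 := rk_le_card' (M := N) (W.erase x)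
    rw [card_erase_of_mem hxW] at h2
    have h3 : 1 ≤ W.card := card_pos.2 ⟨x, hxW⟩
    omega
  · have hxc : x ∈ gr N \ W := mem_sdiff.2 ⟨hx, hxW⟩
    have h1 : rk N (gr N \ W) = rk N ((gr N \ W).erase x) := by
      conv_lhs => rw [← insert_erase hxc]
      exact rk_insert_eq_of_loop hx0 _
    have h2 := rk_le_card' (M := N) ((gr N \ W).erase x)
    rw [card_erase_of_mem hxc] at h2
    have h3 : 1 ≤ (gr N \ W).card := card_pos.2 ⟨x, hxc⟩
    omega

/-- **THE INEQUALITY OF `StarNineSharp` AT A LOOP**: every count vanishes. -/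
theorem inCount_thru_le_of_loop' {x : α} (hx : x ∈ gr N) (hx0 : rk N {x} = 0) (b' e f : α) :
    inCount N 4 e + thruCount N 4 {b', f} + thruCount N 4 {b', e, f} ≤
      inCount N 4 f + thruCount N 4 {e, f} + thruCount N 4 {b', e} := by
  unfold inCount thruCount
  rw [biIndepSets_eq_empty_of_loop_pt hx hx0]
  simp only [filter_empty, card_empty]
  exact le_refl 0

/-- A bi-independent 4-set of a nine-point rank-5 matroid with the series pair `{b, b′}` and a coloop `c` of
`R = N ∖ {b, b′}` (`ρ(E₇ − c) = 3`) contains at most one of `c, b, b′`, and its complement at least two (the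
independent sets inside `E₇ − c` have at most three elements). -/
theorem card_inter_le_one_of_coloop (hn : (gr N).card = 9) (h : SeriesPair N b b') {c : α}
    (hcR : rk N ((((gr N).erase b).erase b').erase c) = 3)
    {W : Finset α} (hW : W ∈ biIndepSets N 4) :
    (W ∩ {c, b, b'}).card ≤ 1 := by
  have hb : b ∈ gr N := h.1; have hb' : b' ∈ gr N := h.2.1; have hbb' : b ≠ b' := h.2.2.1
  obtain ⟨hWg, hW4, hWr, hWc⟩ := mem_biIndepSets.1 hW
  -- the complement meets `{c, b, b′}` in at least two points
  have hcomp : 2 ≤ ((gr N \ W) ∩ {c, b, b'}).card := by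
    by_contra hlt
    push Not at hlt
    have h1 : ((gr N \ W) \ {c, b, b'}).card ≥ 4 := by
      have := card_sdiff_add_card_inter (gr N \ W) ({c, b, b'} : Finset α)
      have h5 : (gr N \ W).card = 5 := by rw [card_sdiff_of_subset hWg, hn, hW4]
      omega
    have h2 : (gr N \ W) \ {c, b, b'} ⊆ (((gr N).erase b).erase b').erase c := by
      intro z hz
      rw [mem_sdiff, mem_sdiff] at hz
      simp only [mem_insert, mem_singleton, not_or] at hz
      exact mem_erase.2 ⟨hz.2.1, mem_erase.2 ⟨hz.2.2.2, mem_erase.2 ⟨hz.2.2.1, hz.1.1⟩⟩⟩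
    have h3 : rk N ((gr N \ W) \ {c, b, b'}) ≤ 3 := by
      have := rk_mono' (M := N) h2
      rw [hcR] at this
      exact this
    -- but a subset of an independent set is independent: its rank is its cardinality
    have h4 : rk N ((gr N \ W) \ {c, b, b'}) = ((gr N \ W) \ {c, b, b'}).card := by
      have hsub : (gr N \ W) \ {c, b, b'} ⊆ gr N \ W := sdiff_subset
      have h6 := rk_union_add_rk_le_of_subset_inter' (N := N) (S := (gr N \ W) \ {c, b, b'})
        (T := (gr N \ W) ∩ {c, b, b'}) (I := ∅) (empty_subset _)
      have h7 : (gr N \ W) \ {c, b, b'} ∪ (gr N \ W) ∩ {c, b, b'} = gr N \ W := sdiff_union_inter _ _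
      rw [h7] at h6
      have h8 := rk_le_card' (M := N) ((gr N \ W) ∩ {c, b, b'})
      have h9 := rk_le_card' (M := N) ((gr N \ W) \ {c, b, b'})
      have h0 : rk N (∅ : Finset α) = 0 := Nat.le_zero.1 ((rk_le_card' (M := N) ∅).trans (by rw [card_empty]))
      have := card_sdiff_add_card_inter (gr N \ W) ({c, b, b'} : Finset α)
      rw [h0] at h6
      omega
    omega
  -- `W` and its complement partition `{c, b, b′}`
  have hpart : (W ∩ {c, b, b'}).card + ((gr N \ W) ∩ {c, b, b'}).card ≤ 3 := by
    have h1 : (W ∩ {c, b, b'}) ∪ ((gr N \ W) ∩ {c, b, b'}) ⊆ {c, b, b'} := by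
      intro z hz; rw [mem_union, mem_inter, mem_inter] at hz
      rcases hz with hz | hz
      · exact hz.2
      · exact hz.2
    have h2 : Disjoint (W ∩ {c, b, b'}) ((gr N \ W) ∩ {c, b, b'}) := by
      rw [disjoint_left]
      intro z hz1 hz2
      exact (mem_sdiff.1 (mem_inter.1 hz2).1).2 (mem_inter.1 hz1).1
    have h3 := card_le_card h1
    rw [card_union_of_disjoint h2] at h3
    have h4 := card_le_three (a := c) (b := b) (c := b')
    omega
  omega

/-- **THE COLOOP `f` OF `R`**: with `ρ(E₇ − f) = 3` every demand is `T + b` with `T ⊆ E₇ − f` of rank 3, and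
`T ↦ T + f` injects the demands into the targets through `f`. -/
theorem inCount_thru_le_of_coloop_f (hn : (gr N).card = 9) (hR : rk N (gr N) = 5)
    (hcf : ∀ x ∈ gr N, rk N ((gr N).erase x) = 5) (h : SeriesPair N b b') {e f : α} (hf : f ∈ gr N)
    (hfb : f ≠ b) (hfb' : f ≠ b') (hE7 : rk N (((gr N).erase b).erase b') = 4)
    (hfR : rk N ((((gr N).erase b).erase b').erase f) = 3) :
    inCount N 4 e + thruCount N 4 {b', f} + thruCount N 4 {b', e, f} ≤
      inCount N 4 f + thruCount N 4 {e, f} + thruCount N 4 {b', e} := by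
  rw [inCount_thru_split']
  have hb : b ∈ gr N := h.1; have hb' : b' ∈ gr N := h.2.1; have hbb' : b ≠ b' := h.2.2.1
  have hfE : f ∈ ((gr N).erase b).erase b' := mem_erase.2 ⟨hfb', mem_erase.2 ⟨hfb, hf⟩⟩
  have hE7g : ((gr N).erase b).erase b' ⊆ gr N := (erase_subset _ _).trans (erase_subset _ _)
  apply card_le_card_of_injOn (fun W => insert f (W.erase b))
  · intro W hW
    simp only [mem_coe, mem_filter] at hW ⊢
    obtain ⟨hWs, ⟨-, hfW⟩, hb'W⟩ := hW
    obtain ⟨hWg, hW4, hWr, hWc⟩ := mem_biIndepSets.1 hWs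
    have hbW : b ∈ W := by
      by_contra hbW
      have hsub : W ⊆ (((gr N).erase b).erase b').erase f := fun z hz =>
        mem_erase.2 ⟨fun h' => hfW (h' ▸ hz), mem_erase.2 ⟨fun h' => hb'W (h' ▸ hz),
          mem_erase.2 ⟨fun h' => hbW (h' ▸ hz), hWg hz⟩⟩⟩
      have := rk_mono' (M := N) hsub
      rw [hfR, hWr, hW4] at this
      omega
    have hTsub : W.erase b ⊆ (((gr N).erase b).erase b').erase f := fun z hz =>
      mem_erase.2 ⟨fun h' => hfW (h' ▸ mem_of_mem_erase hz), mem_erase.2 ⟨fun h' => hb'W (h' ▸ mem_of_mem_erase hz),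
        mem_erase.2 ⟨(mem_erase.1 hz).1, hWg (mem_of_mem_erase hz)⟩⟩⟩
    have hT3 : (W.erase b).card = 3 := by rw [card_erase_of_mem hbW, hW4]
    have hTr : rk N (W.erase b) = 3 := by
      have h1 := rk_le_card' (M := N) (W.erase b)
      have h2 : rk N W ≤ rk N (W.erase b) + 1 := by
        have := rk_insert_le_add_one (N := N) (hWg hbW) (X := W.erase b) ((erase_subset _ _).trans hWg)
        rwa [insert_erase hbW] at this
      rw [hT3] at h1; rw [hWr, hW4] at h2; omega
    have hfT : f ∉ W.erase b := fun h' => hfW (mem_of_mem_erase h')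
    have hBE : insert f (W.erase b) ⊆ ((gr N).erase b).erase b' :=
      insert_subset hfE (hTsub.trans (erase_subset _ _))
    have hB4 : (insert f (W.erase b)).card = 4 := by rw [card_insert_of_notMem hfT, hT3]
    refine ⟨?_, mem_insert_self _ _, ?_⟩
    · rw [mem_biIndepSets_iff_of_subset_E7 h hn hBE hB4]
      constructor
      · have := rk_insert_eq_add_one_of_subset_flat (N := N) (H := (((gr N).erase b).erase b').erase f)
          (S := W.erase b) (z := f) hf ((erase_subset _ _).trans hE7g) hTsub (by rw [insert_erase hfE, hE7, hfR])
        rw [this, hTr]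
      · have hS'sub : ((gr N).erase b).erase b' \ insert f (W.erase b) ⊆ (((gr N).erase b).erase b').erase f := by
          intro z hz
          rw [mem_sdiff] at hz
          exact mem_erase.2 ⟨fun h' => hz.2 (h' ▸ mem_insert_self _ _), hz.1⟩
        have hS'3 : rk N (((gr N).erase b).erase b' \ insert f (W.erase b)) = 3 := by
          have h1 : gr N \ W ⊆ insert b' (insert f (((gr N).erase b).erase b' \ insert f (W.erase b))) := by
            intro z hz
            rw [mem_sdiff] at hz
            by_cases hzb' : z = b'
            · rw [hzb']; exact mem_insert_self _ _
            by_cases hzf : z = f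
            · rw [hzf]; exact mem_insert_of_mem (mem_insert_self _ _)
            · have hzb : z ≠ b := fun h' => hz.2 (h' ▸ hbW)
              refine mem_insert_of_mem (mem_insert_of_mem (mem_sdiff.2 ⟨mem_erase.2 ⟨hzb', mem_erase.2 ⟨hzb, hz.1⟩⟩, ?_⟩))
              intro h'
              rcases mem_insert.1 h' with h'' | h''
              · exact hzf h''
              · exact hz.2 (mem_of_mem_erase h'')
          have h2 := rk_mono' (M := N) h1
          have h3 := rk_insert_le_add_one (N := N) hb' (X := insert f (((gr N).erase b).erase b' \ insert f (W.erase b)))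
            (insert_subset hf (sdiff_subset.trans hE7g))
          have h4 := rk_insert_le_add_one (N := N) hf (X := ((gr N).erase b).erase b' \ insert f (W.erase b))
            (sdiff_subset.trans hE7g)
          have h5 : rk N (((gr N).erase b).erase b' \ insert f (W.erase b)) ≤ 3 := by
            have := rk_mono' (M := N) hS'sub; rwa [hfR] at this
          have h6 : (gr N \ W).card = 5 := by rw [card_sdiff_of_subset hWg, hn, hW4]
          rw [hWc, h6] at h2
          omega
        have hcl : ∀ z ∈ (((gr N).erase b).erase b').erase f,
            rk N (insert z (insert b (insert b' (((gr N).erase b).erase b' \ insert f (W.erase b))))) =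
              rk N (insert b (insert b' (((gr N).erase b).erase b' \ insert f (W.erase b)))) := by
          intro z hz
          exact rk_insert_eq_of_rk_insert_eq_subset' (N := N) ((subset_insert _ _).trans (subset_insert _ _))
            (rk_insert_eq_of_subset_rk_eq' hS'sub (by rw [hfR, hS'3]) (by rw [insert_eq_of_mem hz]))
        have h5 := rk_union_eq_of_forall_insert_eq (N := N)
          (Y := insert b (insert b' (((gr N).erase b).erase b' \ insert f (W.erase b)))) _ hcl
        have h6 : rk N ((gr N).erase f) ≤ rk N (insert b (insert b' (((gr N).erase b).erase b' \ insert f (W.erase b))) ∪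
            (((gr N).erase b).erase b').erase f) := by
          apply rk_mono'
          intro z hz
          by_cases hzb : z = b
          · rw [hzb]; exact mem_union_left _ (mem_insert_self _ _)
          by_cases hzb' : z = b'
          · rw [hzb']; exact mem_union_left _ (mem_insert_of_mem (mem_insert_self _ _))
          · exact mem_union_right _ (mem_erase.2 ⟨(mem_erase.1 hz).1, mem_erase.2 ⟨hzb', mem_erase.2 ⟨hzb, mem_of_mem_erase hz⟩⟩⟩)
        have h7 : rk N (insert b (insert b' (((gr N).erase b).erase b' \ insert f (W.erase b)))) ≤ rk N (gr N) :=
          rk_mono' (insert_subset hb (insert_subset hb' (sdiff_subset.trans hE7g)))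
        rw [hcf f hf, h5] at h6
        rw [hR] at h7
        omega
    · intro h'
      rcases mem_insert.1 h' with h'' | h''
      · exact hfb' h''.symm
      · exact hb'W (mem_of_mem_erase h'')
  · intro W₁ hW₁ W₂ hW₂ heq
    simp only [mem_coe, mem_filter] at hW₁ hW₂
    have hf₁ : f ∉ W₁.erase b := fun h' => hW₁.2.1.2 (mem_of_mem_erase h')
    have hf₂ : f ∉ W₂.erase b := fun h' => hW₂.2.1.2 (mem_of_mem_erase h')
    have hb₁ : b ∈ W₁ := by
      by_contra hbW
      obtain ⟨hWg, hW4, hWr, -⟩ := mem_biIndepSets.1 hW₁.1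
      have hsub : W₁ ⊆ (((gr N).erase b).erase b').erase f := fun z hz =>
        mem_erase.2 ⟨fun h' => hW₁.2.1.2 (h' ▸ hz), mem_erase.2 ⟨fun h' => hW₁.2.2 (h' ▸ hz),
          mem_erase.2 ⟨fun h' => hbW (h' ▸ hz), hWg hz⟩⟩⟩
      have := rk_mono' (M := N) hsub
      rw [hfR, hWr, hW4] at this
      omega
    have hb₂ : b ∈ W₂ := by
      by_contra hbW
      obtain ⟨hWg, hW4, hWr, -⟩ := mem_biIndepSets.1 hW₂.1
      have hsub : W₂ ⊆ (((gr N).erase b).erase b').erase f := fun z hz =>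
        mem_erase.2 ⟨fun h' => hW₂.2.1.2 (h' ▸ hz), mem_erase.2 ⟨fun h' => hW₂.2.2 (h' ▸ hz),
          mem_erase.2 ⟨fun h' => hbW (h' ▸ hz), hWg hz⟩⟩⟩
      have := rk_mono' (M := N) hsub
      rw [hfR, hWr, hW4] at this
      omega
    have heq' : insert f (W₁.erase b) = insert f (W₂.erase b) := heq
    have h1 : (insert f (W₁.erase b)).erase f = (insert f (W₂.erase b)).erase f := by rw [heq']
    rw [erase_insert hf₁, erase_insert hf₂] at h1
    rw [← insert_erase hb₁, ← insert_erase hb₂, h1]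

/-- **THE COLOOP `e` OF `R`**: with `ρ(E₇ − e) = 3` no demand contains `b` (its complement would lie in
`(E₇ − e) + b′`, of rank ≤ 4), so every demand is OFF and the OFF injection `W ↦ (E ∖ W) − b′` applies. -/
theorem inCount_thru_le_of_coloop_e (hn : (gr N).card = 9) (h : SeriesPair N b b') {e f : α} (hf : f ∈ gr N)
    (hfb' : f ≠ b') (heR : rk N ((((gr N).erase b).erase b').erase e) = 3) :
    inCount N 4 e + thruCount N 4 {b', f} + thruCount N 4 {b', e, f} ≤
      inCount N 4 f + thruCount N 4 {e, f} + thruCount N 4 {b', e} := by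
  rw [inCount_thru_split']
  have hb' : b' ∈ gr N := h.2.1
  have hE7g : ((gr N).erase b).erase b' ⊆ gr N := (erase_subset _ _).trans (erase_subset _ _)
  have hoff : ∀ W ∈ (biIndepSets N 4).filter (fun W => (e ∈ W ∧ f ∉ W) ∧ b' ∉ W),
      (gr N \ W).erase b' ∈ biIndepSets N 4 := by
    intro W hW
    rw [mem_filter] at hW
    obtain ⟨hWs, ⟨heW, -⟩, hb'W⟩ := hW
    obtain ⟨hWg, hW4, -, hWc⟩ := mem_biIndepSets.1 hWs
    have hbW : b ∉ W := by
      intro hbW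
      have hsub : gr N \ W ⊆ insert b' ((((gr N).erase b).erase b').erase e \ W) := by
        intro z hz
        rw [mem_sdiff] at hz
        by_cases hzb' : z = b'
        · rw [hzb']; exact mem_insert_self _ _
        · have hzb : z ≠ b := fun h' => hz.2 (h' ▸ hbW)
          have hze : z ≠ e := fun h' => hz.2 (h' ▸ heW)
          exact mem_insert_of_mem (mem_sdiff.2 ⟨mem_erase.2 ⟨hze, mem_erase.2 ⟨hzb', mem_erase.2 ⟨hzb, hz.1⟩⟩⟩, hz.2⟩)
      have h1 := rk_mono' (M := N) hsub
      have h2 := rk_insert_le_add_one (N := N) hb' (X := (((gr N).erase b).erase b').erase e \ W)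
        (sdiff_subset.trans ((erase_subset _ _).trans hE7g))
      have h3 : rk N ((((gr N).erase b).erase b').erase e \ W) ≤ 3 := by
        have := rk_mono' (M := N) (sdiff_subset : (((gr N).erase b).erase b').erase e \ W ⊆ _)
        rwa [heR] at this
      have h4 : (gr N \ W).card = 5 := by rw [card_sdiff_of_subset hWg, hn, hW4]
      rw [hWc, h4] at h1
      omega
    exact compl_erase_mem_of_subset_E7' h hn hWs hbW hb'W
  have heq : (biIndepSets N 4).filter (fun W => (e ∈ W ∧ f ∉ W) ∧ b' ∉ W) =
      (biIndepSets N 4).filter (fun W => ((e ∈ W ∧ f ∉ W) ∧ b' ∉ W) ∧ (gr N \ W).erase b' ∈ biIndepSets N 4) :=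
    filter_congr (fun W hW => ⟨fun hP => ⟨hP, hoff W (mem_filter.2 ⟨hW, hP⟩)⟩, fun hP => hP.1⟩)
  rw [heq]
  refine le_trans (card_off_demands_le (N := N) hf hfb') (card_le_card ?_)
  intro W hW
  rw [mem_filter] at hW ⊢
  exact ⟨hW.1, hW.2.1⟩

end StarSharpAsmA

end PercRepro.Cogirth
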